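import Summits.NavierStokesRegularity.NavierStokesRegularity.Theses.RellichScar
import Summits.NavierStokesRegularity.NavierStokesRegularity.Theorems.ScarRigidity.Negative.LogicAndLoadBearing
import Literature.Analysis.FluidPDE.TypeIAncientMild
import Literature.Analysis.FluidPDE.ParasiticSlabFlow
import Summits.NavierStokesRegularity.NavierStokesRegularity.Theorems.RellichScarScarRigidityCoulombFlux
import Summits.NavierStokesRegularity.NavierStokesRegularity.Theorems.RellichScarScarRigidityCoulombPoisson
import Summits.NavierStokesRegularity.NavierStokesRegularity.Theorems.RellichScarScarRigidityCoulombBounds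
import HarnessLib

/-!
# `ScarRigidity` — line `finite-energy-log-convexity`, stub `stub_coulombEnergyPackage`:
# the Newtonian potential of an apex density as a decaying divergence-free field
# (crux stmt-NavierStokesRegularity-11717)

Helper file 8 of S4-E (`stub_coulombEnergyPackage`). For a `C²` density `w` with the apex bounds
`‖w‖ ≤ A ρ⁻³`, `‖Dw‖ ≤ A₁ ρ⁻²`, `‖D²w‖ ≤ A₂ ρ⁻³` (`ρ = ‖y‖ + a`, `a > 0`) the potential
`ψ = Γ ⋆ w` of `…CoulombPoisson` (which is `C²` with `Δψ = w`) satisfies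

* `exists_newtonPotential_field_bounds` — **`‖ψ(x)‖ ≤ P₀ ‖x‖^{-3/4}` (`x ≠ 0`),
  `‖Dψ(x)‖ ≤ P₁ (1 + ‖x‖)^{-7/4}`, `‖∂ᵢ∂ᵢψ(x)‖ ≤ P₂ (1 + ‖x‖)^{-5/2}`** (the derivative formulas of
  `…CoulombPoisson` against the near/far integral bounds of `…CoulombBounds`, and
  `min(1, ‖x‖^{-s}) ≤ 2^s (1 + ‖x‖)^{-s}`);
* `isDivFree_newtonPotential` — **`div ψ = 0` when `div w = 0`** (`div` of the near part is
  `Γ₀ ⋆ div w = 0`; `div` of the far part is `∫ DΓ∞(x-y)(w(y)) dy = -∫ div_y (Γ∞(x-y) w(y)) dy = 0` by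
  the weighted divergence theorem of `…CoulombFlux`).
-/

noncomputable section

open Set Filter Function MeasureTheory Metric TopologicalSpace
open scoped Topology ENNReal NNReal InnerProductSpace RealInnerProductSpace
open Literature.Analysis.FluidPDE
open Summit.NavierStokesRegularity.NavierStokesRegularity.Theses.RellichScar
open Summit.NavierStokesRegularity.NavierStokesRegularity.Theorems.ScarRigidity.Negative

set_option linter.dupNamespace false

namespace Summit.NavierStokesRegularity.NavierStokesRegularity.Theorems.RellichScarScarRigidity

open Real
open scoped Laplacian

/-! ## From `min(1, ‖x‖^{-s})` to `(1 + ‖x‖)^{-s}` -/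

/-- If `v ≤ Q` and `v ≤ Q ‖x‖^{-s}` for `x ≠ 0` (`Q, s ≥ 0`), then `v ≤ 2^s Q (1 + ‖x‖)^{-s}`. [folklore] -/
theorem le_one_add_norm_rpow_of_le {E : Type*} [NormedAddCommGroup E] {v Q s : ℝ} (hQ : 0 ≤ Q)
    (hs : 0 ≤ s) (x : E) (h1 : v ≤ Q) (h2 : x ≠ 0 → v ≤ Q * ‖x‖ ^ (-s)) :
    v ≤ (2 : ℝ) ^ s * Q * (1 + ‖x‖) ^ (-s) := by
  have hx1 : 0 < 1 + ‖x‖ := by positivity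
  by_cases hx : ‖x‖ ≤ 1
  · -- `(1 + ‖x‖)/2 ≤ 1`
    have h : (1 : ℝ) ≤ (2 : ℝ) ^ s * (1 + ‖x‖) ^ (-s) := by
      rw [Real.rpow_neg hx1.le, ← div_eq_mul_inv, ← Real.div_rpow (by norm_num) hx1.le]
      exact Real.one_le_rpow (by rw [le_div_iff₀ hx1]; linarith) hs
    calc v ≤ Q := h1
      _ ≤ Q * ((2 : ℝ) ^ s * (1 + ‖x‖) ^ (-s)) := le_mul_of_one_le_right hQ h
      _ = (2 : ℝ) ^ s * Q * (1 + ‖x‖) ^ (-s) := by ring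
  · rw [not_le] at hx
    have hx0 : 0 < ‖x‖ := by linarith
    have hxne : x ≠ 0 := norm_pos_iff.1 hx0
    -- `‖x‖⁻¹ ≤ 2 (1 + ‖x‖)⁻¹`
    have h : ‖x‖ ^ (-s) ≤ (2 : ℝ) ^ s * (1 + ‖x‖) ^ (-s) := by
      rw [Real.rpow_neg hx1.le, Real.rpow_neg hx0.le, ← Real.inv_rpow hx0.le, ← Real.inv_rpow hx1.le,
        ← Real.mul_rpow (by norm_num) (inv_nonneg.2 hx1.le)]
      refine Real.rpow_le_rpow (inv_nonneg.2 hx0.le) ?_ hs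
      rw [← div_eq_mul_inv, le_div_iff₀ hx1, inv_mul_le_iff₀ hx0]
      linarith
    calc v ≤ Q * ‖x‖ ^ (-s) := h2 hxne
      _ ≤ Q * ((2 : ℝ) ^ s * (1 + ‖x‖) ^ (-s)) := mul_le_mul_of_nonneg_left h hQ
      _ = (2 : ℝ) ^ s * Q * (1 + ‖x‖) ^ (-s) := by ring

/-! ## The potential as a decaying field -/

/-- The pure second derivative `∂ₑ∂ₑ v` is bounded by the norm of the second derivative for a unit
vector `e`. [folklore] -/
theorem norm_fderiv_fderiv_apply_le {v : (EuclideanSpace ℝ (Fin 3)) → (EuclideanSpace ℝ (Fin 3))}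
    (hv : ContDiff ℝ 2 v) (x e : EuclideanSpace ℝ (Fin 3)) (he : ‖e‖ = 1) :
    ‖fderiv ℝ (fun y => fderiv ℝ v y e) x e‖ ≤ ‖iteratedFDeriv ℝ 2 v x‖ := by
  rw [fderiv_fderiv_apply_const hv x e]
  calc ‖iteratedFDeriv ℝ 2 v x ![e, e]‖ ≤ ‖iteratedFDeriv ℝ 2 v x‖ * ∏ i, ‖(![e, e] : Fin 2 → _) i‖ :=
        ContinuousMultilinearMap.le_opNorm _ _
    _ = ‖iteratedFDeriv ℝ 2 v x‖ := by simp [Fin.prod_univ_two, he]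

/-- **The Newtonian potential of a `C²` apex density is a decaying field**:
`‖ψ(x)‖ ≤ P₀ ‖x‖^{-3/4}` for `x ≠ 0`, `‖Dψ(x)‖ ≤ P₁ (1+‖x‖)^{-7/4}`,
`‖∂ᵢ∂ᵢψ(x)‖ ≤ P₂ (1+‖x‖)^{-5/2}` in the standard basis, where `ψ(x) = ∫ Γ(x-y) w(y) dy`. [folklore] -/
theorem exists_newtonPotential_field_bounds
    {w : (EuclideanSpace ℝ (Fin 3)) → (EuclideanSpace ℝ (Fin 3))} (hw : ContDiff ℝ 2 w)
    {a A A₁ A₂ : ℝ} (ha : 0 < a) (hA : 0 ≤ A) (hA₁ : 0 ≤ A₁) (hA₂ : 0 ≤ A₂)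
    (hwb : ∀ y, ‖w y‖ ≤ A * ((‖y‖ + a) ^ 3)⁻¹)
    (hw1 : ∀ y, ‖fderiv ℝ w y‖ ≤ A₁ * ((‖y‖ + a) ^ 2)⁻¹)
    (hw2 : ∀ y, ‖iteratedFDeriv ℝ 2 w y‖ ≤ A₂ * ((‖y‖ + a) ^ 3)⁻¹) :
    ∃ P₀ P₁ P₂ : ℝ, 0 ≤ P₀ ∧ 0 ≤ P₁ ∧ 0 ≤ P₂ ∧
      (∀ x : EuclideanSpace ℝ (Fin 3), x ≠ 0 →
        ‖∫ y, newtonKernel (x - y) • w y‖ ≤ P₀ * ‖x‖ ^ (-(3 / 4 : ℝ))) ∧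
      (∀ x : EuclideanSpace ℝ (Fin 3),
        ‖fderiv ℝ (fun x => ∫ y, newtonKernel (x - y) • w y) x‖ ≤ P₁ * (1 + ‖x‖) ^ (-(7 / 4 : ℝ))) ∧
      (∀ (x : EuclideanSpace ℝ (Fin 3)) (i : Fin 3),
        ‖fderiv ℝ (fun y => fderiv ℝ (fun x => ∫ y, newtonKernel (x - y) • w y) y
          (EuclideanSpace.basisFun (Fin 3) ℝ i)) x (EuclideanSpace.basisFun (Fin 3) ℝ i)‖ ≤
          P₂ * (1 + ‖x‖) ^ (-(5 / 2 : ℝ))) := by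
  set e := EuclideanSpace.basisFun (Fin 3) ℝ with he_def
  obtain ⟨K, hK, hdec⟩ := exists_integral_norm_newtonKernel_smul_le
  obtain ⟨Pf, hPf, hfar⟩ := exists_far_integrals_le ha
  obtain ⟨Pn₁, hPn₁, hnear₁⟩ := exists_near_integrals_le ha 2 (s := 7 / 4) (by norm_num) (by norm_num)
  obtain ⟨Pn₂, hPn₂, hnear₂⟩ := exists_near_integrals_le ha 3 (s := 5 / 2) (by norm_num) (by norm_num)
  set Q₁ : ℝ := Pn₁ * A₁ + Pf * A with hQ₁
  set Q₂ : ℝ := Pn₂ * A₂ + Pf * A with hQ₂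
  have hQ₁0 : 0 ≤ Q₁ := by positivity
  have hQ₂0 : 0 ≤ Q₂ := by positivity
  refine ⟨K * A * a ^ (-(1 / 4 : ℝ)), (2 : ℝ) ^ (7 / 4 : ℝ) * Q₁, (2 : ℝ) ^ (5 / 2 : ℝ) * Q₂,
    by positivity, by positivity, by positivity, fun x hx => ?_, fun x => ?_, fun x i => ?_⟩
  · exact (norm_integral_le_integral_norm _).trans (hdec a A ha hA w hwb x hx)
  · -- the gradient
    have hb : ∀ b : EuclideanSpace ℝ (Fin 3),
        (‖fderiv ℝ (fun x => ∫ y, newtonKernel (x - y) • w y) x b‖ ≤ Q₁ * ‖b‖) ∧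
        (x ≠ 0 → ‖fderiv ℝ (fun x => ∫ y, newtonKernel (x - y) • w y) x b‖ ≤
          Q₁ * ‖b‖ * ‖x‖ ^ (-(7 / 4 : ℝ))) := by
      intro b
      have hG : ∀ y, ‖fderiv ℝ w y b‖ ≤ A₁ * ‖b‖ * ((‖y‖ + a) ^ 2)⁻¹ := fun y =>
        (ContinuousLinearMap.le_opNorm _ _).trans (by
          calc ‖fderiv ℝ w y‖ * ‖b‖ ≤ A₁ * ((‖y‖ + a) ^ 2)⁻¹ * ‖b‖ :=
                mul_le_mul_of_nonneg_right (hw1 y) (norm_nonneg _)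
            _ = A₁ * ‖b‖ * ((‖y‖ + a) ^ 2)⁻¹ := by ring)
      obtain ⟨hn, hn'⟩ := hnear₁ (A₁ * ‖b‖) (by positivity) (fun y => fderiv ℝ w y b) hG x
      obtain ⟨hf, hf', -, -⟩ := hfar A hA w hwb x b b
      rw [fderiv_newtonPotential_apply hw ha hA hwb x b]
      constructor
      · calc ‖(∫ z, newtonNear 1 2 z • fderiv ℝ w (x - z) b) +
              ∫ y, fderiv ℝ (newtonFar 1 2) (x - y) b • w y‖
            ≤ (∫ z, ‖newtonNear 1 2 z • fderiv ℝ w (x - z) b‖) +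
              ∫ y, ‖fderiv ℝ (newtonFar 1 2) (x - y) b • w y‖ :=
              (norm_add_le _ _).trans (add_le_add (norm_integral_le_integral_norm _)
                (norm_integral_le_integral_norm _))
          _ ≤ Pn₁ * (A₁ * ‖b‖) + Pf * A * ‖b‖ := add_le_add hn hf
          _ = Q₁ * ‖b‖ := by simp only [hQ₁]; ring
      · intro hx
        calc ‖(∫ z, newtonNear 1 2 z • fderiv ℝ w (x - z) b) +
              ∫ y, fderiv ℝ (newtonFar 1 2) (x - y) b • w y‖
            ≤ (∫ z, ‖newtonNear 1 2 z • fderiv ℝ w (x - z) b‖) +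
              ∫ y, ‖fderiv ℝ (newtonFar 1 2) (x - y) b • w y‖ :=
              (norm_add_le _ _).trans (add_le_add (norm_integral_le_integral_norm _)
                (norm_integral_le_integral_norm _))
          _ ≤ Pn₁ * (A₁ * ‖b‖) * ‖x‖ ^ (-(7 / 4 : ℝ)) + Pf * A * ‖b‖ * ‖x‖ ^ (-(7 / 4 : ℝ)) :=
              add_le_add (hn' hx) (hf' hx)
          _ = Q₁ * ‖b‖ * ‖x‖ ^ (-(7 / 4 : ℝ)) := by simp only [hQ₁]; ring
    have hop1 : ‖fderiv ℝ (fun x => ∫ y, newtonKernel (x - y) • w y) x‖ ≤ Q₁ :=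
      ContinuousLinearMap.opNorm_le_bound _ hQ₁0 fun b => (hb b).1
    have hop2 : x ≠ 0 → ‖fderiv ℝ (fun x => ∫ y, newtonKernel (x - y) • w y) x‖ ≤
        Q₁ * ‖x‖ ^ (-(7 / 4 : ℝ)) := fun hx =>
      ContinuousLinearMap.opNorm_le_bound _ (by positivity) fun b => by
        calc ‖fderiv ℝ (fun x => ∫ y, newtonKernel (x - y) • w y) x b‖
            ≤ Q₁ * ‖b‖ * ‖x‖ ^ (-(7 / 4 : ℝ)) := (hb b).2 hx
          _ = Q₁ * ‖x‖ ^ (-(7 / 4 : ℝ)) * ‖b‖ := by ring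
    exact le_one_add_norm_rpow_of_le hQ₁0 (by norm_num) x hop1 hop2
  · -- the pure second derivatives
    have hei : ‖e i‖ = 1 := e.norm_eq_one i
    have hG : ∀ y, ‖fderiv ℝ (fun y => fderiv ℝ w y (e i)) y (e i)‖ ≤ A₂ * ((‖y‖ + a) ^ 3)⁻¹ :=
      fun y => (norm_fderiv_fderiv_apply_le hw y (e i) hei).trans (hw2 y)
    obtain ⟨hn, hn'⟩ := hnear₂ A₂ hA₂ (fun y => fderiv ℝ (fun y => fderiv ℝ w y (e i)) y (e i)) hG x
    obtain ⟨-, -, hf, hf'⟩ := hfar A hA w hwb x (e i) (e i)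
    rw [hei, mul_one, mul_one] at hf hf'
    rw [fderiv_fderiv_newtonPotential_apply hw ha hA hwb x (e i) (e i)]
    have h1 : ‖(∫ z, newtonNear 1 2 z • fderiv ℝ (fun y => fderiv ℝ w y (e i)) (x - z) (e i)) +
        ∫ y, fderiv ℝ (fun z => fderiv ℝ (newtonFar 1 2) z (e i)) (x - y) (e i) • w y‖ ≤ Q₂ := by
      calc _ ≤ (∫ z, ‖newtonNear 1 2 z • fderiv ℝ (fun y => fderiv ℝ w y (e i)) (x - z) (e i)‖) +
            ∫ y, ‖fderiv ℝ (fun z => fderiv ℝ (newtonFar 1 2) z (e i)) (x - y) (e i) • w y‖ :=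
            (norm_add_le _ _).trans (add_le_add (norm_integral_le_integral_norm _)
              (norm_integral_le_integral_norm _))
        _ ≤ Pn₂ * A₂ + Pf * A := add_le_add hn hf
    have h2 : x ≠ 0 →
        ‖(∫ z, newtonNear 1 2 z • fderiv ℝ (fun y => fderiv ℝ w y (e i)) (x - z) (e i)) +
          ∫ y, fderiv ℝ (fun z => fderiv ℝ (newtonFar 1 2) z (e i)) (x - y) (e i) • w y‖ ≤
          Q₂ * ‖x‖ ^ (-(5 / 2 : ℝ)) := fun hx => by
      calc _ ≤ (∫ z, ‖newtonNear 1 2 z • fderiv ℝ (fun y => fderiv ℝ w y (e i)) (x - z) (e i)‖) +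
            ∫ y, ‖fderiv ℝ (fun z => fderiv ℝ (newtonFar 1 2) z (e i)) (x - y) (e i) • w y‖ :=
            (norm_add_le _ _).trans (add_le_add (norm_integral_le_integral_norm _)
              (norm_integral_le_integral_norm _))
        _ ≤ Pn₂ * A₂ * ‖x‖ ^ (-(5 / 2 : ℝ)) + Pf * A * ‖x‖ ^ (-(5 / 2 : ℝ)) :=
            add_le_add (hn' hx) (hf' hx)
        _ = Q₂ * ‖x‖ ^ (-(5 / 2 : ℝ)) := by simp only [hQ₂]; ring
    exact le_one_add_norm_rpow_of_le hQ₂0 (by norm_num) x h1 h2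

/-! ## The potential of a divergence-free density is divergence free -/

/-- **The far part carries no divergence**: `∫ DΓ∞(x-y)(w(y)) dy = 0` for a `C¹` divergence-free
apex density (`DΓ∞(x-y)(w(y)) = -div_y (Γ∞(x-y) w(y))`, and the weighted divergence theorem: the
field `y ↦ Γ∞(x-y) w(y)` is `O((1+‖x-y‖)⁻¹ ρ⁻³)`, its divergence `O((1+‖x-y‖)⁻² ρ⁻³)`). [folklore] -/
theorem integral_fderiv_newtonFar_apply_eq_zero
    {w : (EuclideanSpace ℝ (Fin 3)) → (EuclideanSpace ℝ (Fin 3))} (hw : ContDiff ℝ 1 w)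
    (hdiv : VectorCalculus.IsDivFree w) {a A : ℝ} (ha : 0 < a)
    (hwb : ∀ y, ‖w y‖ ≤ A * ((‖y‖ + a) ^ 3)⁻¹) (x : EuclideanSpace ℝ (Fin 3)) :
    ∫ y, fderiv ℝ (newtonFar 1 2) (x - y) (w y) = 0 := by
  obtain ⟨K₀, K₁, K₂, hK₀, hK₁, -, hb0, hb1, -, -⟩ := exists_newtonFar_kernel_bounds
  have hA : 0 ≤ A := by
    have := (norm_nonneg _).trans (hwb 0)
    have hpos : (0 : ℝ) < ((‖(0 : EuclideanSpace ℝ (Fin 3))‖ + a) ^ 3)⁻¹ := by positivity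
    nlinarith
  have hΓ : ContDiff ℝ 1 (newtonFar (1 : ℝ) 2) := contDiff_newtonFar one_pos one_lt_two
  have hθ : ContDiff ℝ 1 fun y : EuclideanSpace ℝ (Fin 3) => newtonFar 1 2 (x - y) :=
    hΓ.comp (contDiff_const.sub contDiff_id)
  -- the derivative of `y ↦ Γ∞(x - y)`
  have hθd : ∀ y, fderiv ℝ (fun y => newtonFar 1 2 (x - y)) y =
      -(fderiv ℝ (newtonFar 1 2) (x - y)) := by
    intro y
    have h : HasFDerivAt (fun y => newtonFar 1 2 (x - y))
        ((fderiv ℝ (newtonFar 1 2) (x - y)).comp ((0 : _ →L[ℝ] _) - ContinuousLinearMap.id ℝ _)) y :=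
      ((hΓ.differentiable one_ne_zero) (x - y)).hasFDerivAt.comp y
        ((hasFDerivAt_const x y).sub (hasFDerivAt_id y))
    rw [h.fderiv]
    ext v
    simp
  -- the divergence of `Z(y) = Γ∞(x-y) w(y)`
  have hdivZ : ∀ y, VectorCalculus.divergence (fun y => newtonFar 1 2 (x - y) • w y) y =
      -(fderiv ℝ (newtonFar 1 2) (x - y) (w y)) := by
    intro y
    rw [divergence_smul_apply ((hθ.differentiable one_ne_zero) y) ((hw.differentiable one_ne_zero) y),
      hdiv y, mul_zero, zero_add, gradient, real_inner_comm, InnerProductSpace.toDual_symm_apply, hθd]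
    rfl
  -- integrability of the divergence and of the weighted field
  have hdi : Integrable (fun y => VectorCalculus.divergence (fun y => newtonFar 1 2 (x - y) • w y) y)
      volume := by
    simp_rw [hdivZ]
    refine ((((integrable_inv_pow_mul_inv_cube x ha (le_refl 2)).1).const_mul (K₁ * A)).mono' ?_
      (Eventually.of_forall fun y => ?_)).neg
    · exact (((hΓ.continuous_fderiv one_ne_zero).comp (continuous_const.sub continuous_id)).clm_apply
        hw.continuous).aestronglyMeasurable
    · calc ‖fderiv ℝ (newtonFar 1 2) (x - y) (w y)‖
          ≤ ‖fderiv ℝ (newtonFar 1 2) (x - y)‖ * ‖w y‖ := ContinuousLinearMap.le_opNorm _ _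
        _ ≤ K₁ * ((1 + ‖x - y‖) ^ 2)⁻¹ * (A * ((‖y‖ + a) ^ 3)⁻¹) :=
            mul_le_mul (hb1 _) (hwb y) (norm_nonneg _) (by positivity)
        _ = K₁ * A * (((1 + ‖x - y‖) ^ 2)⁻¹ * ((‖y‖ + a) ^ 3)⁻¹) := by ring
  have hwt : Integrable (fun y => (1 + ‖y‖)⁻¹ * ‖newtonFar 1 2 (x - y) • w y‖) volume := by
    refine (((integrable_inv_mul_inv_cube x ha).1).const_mul (K₀ * A)).mono' ?_
      (Eventually.of_forall fun y => ?_)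
    · exact ((continuous_const.add continuous_norm).inv₀
        (fun y => (by positivity : (0 : ℝ) < 1 + ‖y‖).ne')).aestronglyMeasurable.mul
        (((hΓ.continuous.comp (continuous_const.sub continuous_id)).smul hw.continuous).norm).aestronglyMeasurable
    · have hy1 : (1 : ℝ) ≤ 1 + ‖y‖ := by linarith [norm_nonneg y]
      rw [Real.norm_of_nonneg (by positivity), norm_smul, Real.norm_eq_abs]
      calc (1 + ‖y‖)⁻¹ * (|newtonFar 1 2 (x - y)| * ‖w y‖)
          ≤ 1 * (K₀ * (1 + ‖x - y‖)⁻¹ * (A * ((‖y‖ + a) ^ 3)⁻¹)) :=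
            mul_le_mul (inv_le_one_of_one_le₀ hy1) (mul_le_mul (hb0 _) (hwb y) (norm_nonneg _)
              (by positivity)) (by positivity) zero_le_one
        _ = K₀ * A * ((1 + ‖x - y‖)⁻¹ * ((‖y‖ + a) ^ 3)⁻¹) := by ring
  have h := integral_divergence_eq_zero_of_weighted (Z := fun y => newtonFar 1 2 (x - y) • w y)
    (hθ.smul hw) hwt hdi
  rw [integral_congr_ae (Eventually.of_forall hdivZ), integral_neg, neg_eq_zero] at h
  exact h

/-- **The Newtonian potential of a divergence-free `C²` apex density is divergence free**:
`div ψ = Σᵢ ⟪eᵢ, ∂ᵢψ⟫ = ∫ Γ₀(z) div w(x-z) dz + ∫ DΓ∞(x-y)(w(y)) dy = 0`. [folklore] -/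
theorem isDivFree_newtonPotential
    {w : (EuclideanSpace ℝ (Fin 3)) → (EuclideanSpace ℝ (Fin 3))} (hw : ContDiff ℝ 2 w)
    (hdiv : VectorCalculus.IsDivFree w) {a A : ℝ} (ha : 0 < a) (hA : 0 ≤ A)
    (hwb : ∀ y, ‖w y‖ ≤ A * ((‖y‖ + a) ^ 3)⁻¹) :
    VectorCalculus.IsDivFree fun x => ∫ y, newtonKernel (x - y) • w y := by
  intro x
  set e := EuclideanSpace.basisFun (Fin 3) ℝ with he_def
  obtain ⟨K₀, K₁, K₂, hK₀, hK₁, -, hb0, hb1, -, -⟩ := exists_newtonFar_kernel_bounds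
  have hw1 : ContDiff ℝ 1 w := hw.of_le one_le_two
  have hΓ1 : ContDiff ℝ 1 (newtonFar (1 : ℝ) 2) := contDiff_newtonFar one_pos one_lt_two
  -- integrability of the two applied integrands
  have hni : ∀ b, Integrable (fun z => newtonNear 1 2 z • fderiv ℝ w (x - z) b) volume := fun b =>
    integrable_smul_comp_sub (integrable_newtonNear zero_le_one one_lt_two)
      (newtonNear_eq_zero_of_lt zero_le_one one_lt_two)
      ((hw1.continuous_fderiv one_ne_zero).clm_apply continuous_const) x
  have hfi : ∀ b, Integrable (fun y => fderiv ℝ (newtonFar 1 2) (x - y) b • w y) volume := by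
    intro b
    refine integrable_of_norm_le_weight ((((hΓ1.continuous_fderiv one_ne_zero).comp
      (continuous_const.sub continuous_id)).clm_apply continuous_const).smul hw.continuous) x ha
      (M := K₁ * ‖b‖ * A) fun y => ?_
    rw [norm_smul]
    calc ‖fderiv ℝ (newtonFar 1 2) (x - y) b‖ * ‖w y‖
        ≤ (K₁ * ((1 + ‖x - y‖) ^ 2)⁻¹ * ‖b‖) * (A * ((‖y‖ + a) ^ 3)⁻¹) :=
          mul_le_mul ((ContinuousLinearMap.le_opNorm _ _).trans
            (mul_le_mul_of_nonneg_right (hb1 _) (norm_nonneg _))) (hwb y) (norm_nonneg _)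
            (by positivity)
      _ = K₁ * ‖b‖ * A * (((1 + ‖x - y‖) ^ 2)⁻¹ * ((‖y‖ + a) ^ 3)⁻¹) := by ring
  rw [divergence_eq_sum_inner_fderiv e]
  simp_rw [fderiv_newtonPotential_apply hw ha hA hwb x, inner_add_right, Finset.sum_add_distrib]
  -- the near sum is `∫ Γ₀ div w(x - ·) = 0`
  have hnear : ∑ i, ⟪e i, ∫ z, newtonNear 1 2 z • fderiv ℝ w (x - z) (e i)⟫ = 0 := by
    simp_rw [← integral_inner (hni _), real_inner_smul_right]
    rw [← integral_finsetSum _ fun i _ => ((hni (e i)).inner_const (e i) |>.congr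
      (Eventually.of_forall fun z => by simp [real_inner_smul_right, real_inner_comm]))]
    refine integral_eq_zero_of_ae (Eventually.of_forall fun z => ?_)
    show ∑ i, newtonNear 1 2 z * ⟪e i, fderiv ℝ w (x - z) (e i)⟫ = 0
    rw [← Finset.mul_sum, ← divergence_eq_sum_inner_fderiv e w (x - z), hdiv (x - z), mul_zero]
  -- the far sum is `∫ DΓ∞(x-y)(w(y)) dy = 0`
  have hfar : ∑ i, ⟪e i, ∫ y, fderiv ℝ (newtonFar 1 2) (x - y) (e i) • w y⟫ = 0 := by
    simp_rw [← integral_inner (hfi _), real_inner_smul_right]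
    rw [← integral_finsetSum _ fun i _ => ((hfi (e i)).inner_const (e i) |>.congr
      (Eventually.of_forall fun y => by simp [real_inner_smul_right, real_inner_comm]))]
    rw [← integral_fderiv_newtonFar_apply_eq_zero hw1 hdiv ha hwb x]
    refine integral_congr_ae (Eventually.of_forall fun y => ?_)
    calc ∑ i, fderiv ℝ (newtonFar 1 2) (x - y) (e i) * ⟪e i, w y⟫
        = fderiv ℝ (newtonFar 1 2) (x - y) (∑ i, ⟪e i, w y⟫ • e i) := by
          rw [map_sum]
          exact Finset.sum_congr rfl fun i _ => by rw [map_smul, smul_eq_mul, mul_comm]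
      _ = fderiv ℝ (newtonFar 1 2) (x - y) (w y) := by rw [e.sum_repr' (w y)]
  rw [hnear, hfar, add_zero]

/-! ## Registered sub-goal (helper stub of `stub_coulombEnergyPackage`) -/

/-- **Registered helper stub `stub_newtonPotentialDivFree`** (crux stmt-NavierStokesRegularity-11717,
line `finite-energy-log-convexity`, helper of S4-E): the Newtonian potential of a divergence-free `C²`
apex density is divergence free, as registered. [folklore] -/
theorem stub_newtonPotentialDivFree :
    ∀ (w : EuclideanSpace ℝ (Fin 3) → EuclideanSpace ℝ (Fin 3)) (a A : ℝ), ContDiff ℝ 2 w →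
      VectorCalculus.IsDivFree w → 0 < a → 0 ≤ A → (∀ y, ‖w y‖ ≤ A * ((‖y‖ + a) ^ 3)⁻¹) →
      VectorCalculus.IsDivFree fun x => ∫ y, newtonKernel (x - y) • w y :=
  fun _w _a _A hw hdiv ha hA hwb => isDivFree_newtonPotential hw hdiv ha hA hwb

end Summit.NavierStokesRegularity.NavierStokesRegularity.Theorems.RellichScarScarRigidity

end
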